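import Mathlib
import Summits.ValiantsHypothesis.ValiantsHypothesis.Theorems.MatrixDescartes.Negative.MatrixDescartesFalseOfTropicalMonster

/-!
# `TropicalB` (stmt-ValiantsHypothesis-19771) — the COMPARABILITY-SUM LAW: two registers coupled only through an
# order constraint `y < p` carry at most `(N+U)·L·(⌊log₂ L⌋ + 1)` dominant terms

Helper file for the crux `Theses.KPlusLogSqLaw.TropicalB` (`--supports stmt-ValiantsHypothesis-19771 --as helper`;
the seat's registered stub `stub_tropFat` is ⟺ the crux by `…TropicalBRegimeCollapse`).  HONEST FRAMING: a structure
theorem about dominance designs in the tree's vocabulary (`IsDominant`, `tropWeight`, `termSign` of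
`…MatrixDescartesFalseOfTropicalMonster`).  It bounds how many dominant terms a particular kind of SUB-FAMILY of the
terms of an ARBITRARY design can contribute; it proves nothing about `TropicalB` itself and bears on neither
`WeakLifting`, B, `MatrixDescartes` (stmt-18050) nor VP ≠ VNP.

## Statement (`ComparabilitySum.card_dominant_le`)
Inside any design `(d, v, ε)` of format `(m, K)` take terms `τ j y p u` (`j < N`, `y, p < L`, `u < U`) which, whenever
`y < p`, are present, pairwise distinct, and have weights
`tropWeight d v θ (τ j y p u) = θ · (s₁ j y + s₂ p u) − (A j y + B p u)`
for arbitrary integer tables `s₁, A` (first register, indexed by `(j, y)`) and `s₂, B` (second register, `(p, u)`):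
slope and valuation ADD over the registers, which interact ONLY through the comparability constraint `y < p` between
their positions in a common window of length `L`.  THEN at most `(N + U) · L · (Nat.log 2 L + 1)` such members are
dominant (each at some integer slope, against ALL present terms of the design).  Slope counting alone allows every
feasible `(j, y, p, u)`, `≍ N·U·L²`; at the natural sizes `N ≍ U ≍ L ≍ m/3` the law is `O(m² log m)` against a cubic ceiling.

## Proof (= Gusfield's halving, run on the POSITION axis of the constraint instead of on path length)
Split the window at its midpoint.  A dominant member has both positions in the left half, both in the right half, or
CROSSES the midpoint (`y < mid ≤ p`).  Crossing members are pairwise unconstrained (every left `(j,y)` is compatible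
with every right `(p,u)`), so along increasing slope their first registers advance through the `≤ N·a` left points
with strictly increasing `s₁` and their second registers through the `≤ U·b` right points, at least one register moving
at each step (`s1_lt_of_cross`, `s2_lt_of_cross`: the four-term exchange `(j,y,p,u),(j',y',p',u') ↔ (j',y',p,u),
(j,y,p',u')`, both cross pairs feasible) — a monotone staircase, hence `≤ N·a + U·b` of them (`cross_card_le`, via
the counting lemma `card_le_of_biMonotone` applied to the two RANK statistics).  Recurse dyadically:
`T(len) ≤ T(⌊len/2⌋) + T(⌈len/2⌉) + N·⌊len/2⌋ + U·⌈len/2⌉`, so `T(len) ≤ (N+U)·len·k` for `len ≤ 2^k`.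

## Why this family (located reading; numbers, not adjectives)
* THE TWO-PIVOT INTERVAL REGISTER.  On an upper-Hessenberg support take the diagonal, the subdiagonal, and wrap
  entries `(a, b)` with `a ≤ P ≤ b < Q` and `(a', b')` with `P < a' ≤ Q ≤ b'` (diagonal entries at the pivots `P, Q`
  absent); give the subdiagonal the classes of the three regions `[0,P)`, `[P,Q)`, `[Q,M)` and everything else class
  0 (K = 4).  Its perfect matchings are EXACTLY the pairs of interval cycles `[a,b] ∋ P`, `[a',b'] ∋ Q` with `b < a'`
  (the two-pivot analogue of `CoupledRegister.rigid`, val-sym-trop-p5 p455706 — rigidity is NOT filed here), slope and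
  valuation are sums over the two cycles, and the only interaction is `b < a'`: this file's hypotheses with
  `(j, y) = (a, b − P)`, `(p, u) = (a' − P, b')`, `N = P + 1`, `L = Q − P + 1`, `U = M − Q` (a column of wrap
  entries per digit).  The located hope for a THIRD multiplying digit at K = 4 was a «shared pool / free
  intermediate index» between two coupled registers (val-sym-trop-p5 INTERACTION-GRAPH §4, §7(ii); val-sym-trop-p2
  REGISTERS R8–R15); the two-pivot register is its smallest instance (digits `a`, `b'` and the pool `(b, a')` with
  slope reading only the gap `a' − b`), and by this file it carries `O(M² log M)` dominant terms — quadratic up to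
  the logarithm, like every other located mechanism («exponent 2»).  The unconstrained variant (all `(y, p)`) is a
  direct sum and needs no theorem (breakpoints add); the content is exactly the price of the order constraint: ONE
  logarithm, not a third factor.
* CHAINS.  `r` interval cycles through pivots `P₁ < … < P_r` give a chain of `r` registers with `r − 1` comparability
  constraints in disjoint windows; the same halving (cross members = a direct sum of a shorter chain restricted to
  half-windows) bounds them by `(#register points) · O(log M)^{r−1}` — recorded in the seat memo
  HOME/val-sym-trop-p2/g4/PASS-THROUGH.md, not filed.
* WHAT IT IS NOT.  Not a bound on designs (terms outside the family are not counted); not a statement about `K`.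
-/

set_option linter.dupNamespace false
set_option autoImplicit false

namespace Summit.ValiantsHypothesis.ValiantsHypothesis.Theorems.KPlusLogSqLaw.ComparabilitySum

open Summit.ValiantsHypothesis.ValiantsHypothesis.Theorems.MatrixDescartes.Negative
open Finset

/-- A finite set on which two `ℕ`-valued statistics `f` (non-increasing along the set's hidden order) and `g`
(non-decreasing) form a STRICT chain — any two distinct members are comparable, with at least one strict
inequality — has at most `(max f − min f) + (max g − min g) + 1` members: the map `a ↦ (max f − f a) + (g a − min g)`
is injective into a range. [folklore] -/
theorem card_le_of_biMonotone {α : Type*} (s : Finset α) (hs : s.Nonempty) (f g : α → ℕ)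
    (hch : ∀ a ∈ s, ∀ b ∈ s, a ≠ b →
      (f b ≤ f a ∧ g a ≤ g b ∧ (f b < f a ∨ g a < g b)) ∨
      (f a ≤ f b ∧ g b ≤ g a ∧ (f a < f b ∨ g b < g a))) :
    s.card ≤ (s.sup' hs f - s.inf' hs f) + (s.sup' hs g - s.inf' hs g) + 1 := by
  classical
  have hfM : ∀ a ∈ s, f a ≤ s.sup' hs f := fun a ha => Finset.le_sup' f ha
  have hfm : ∀ a ∈ s, s.inf' hs f ≤ f a := fun a ha => Finset.inf'_le f ha
  have hgM : ∀ a ∈ s, g a ≤ s.sup' hs g := fun a ha => Finset.le_sup' g ha; have hgm : ∀ a ∈ s, s.inf' hs g ≤ g a := fun a ha => Finset.inf'_le g ha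
  have hmaps : ∀ a ∈ s, (s.sup' hs f - f a) + (g a - s.inf' hs g) ∈
      Finset.range ((s.sup' hs f - s.inf' hs f) + (s.sup' hs g - s.inf' hs g) + 1) := by
    intro a ha
    have h1 := hfM a ha; have h2 := hfm a ha; have h3 := hgM a ha; have h4 := hgm a ha
    simp only [Finset.mem_range]
    omega
  have hinj : Set.InjOn (fun a => (s.sup' hs f - f a) + (g a - s.inf' hs g)) s := by
    intro a ha b hb hab
    by_contra hne
    have h1 := hfM a (Finset.mem_coe.1 ha); have h2 := hgm a (Finset.mem_coe.1 ha)
    have h3 := hfM b (Finset.mem_coe.1 hb); have h4 := hgm b (Finset.mem_coe.1 hb)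
    simp only at hab
    rcases hch a (Finset.mem_coe.1 ha) b (Finset.mem_coe.1 hb) hne with ⟨h5, h6, h7⟩ | ⟨h5, h6, h7⟩ <;>
      rcases h7 with h7 | h7 <;> omega
  calc s.card ≤ (Finset.range ((s.sup' hs f - s.inf' hs f) + (s.sup' hs g - s.inf' hs g) + 1)).card :=
        Finset.card_le_card_of_injOn _ hmaps hinj
    _ = _ := Finset.card_range _


section Family

variable {m K N L U : ℕ}
  (d : Fin K → ℕ) (v ε : Fin m → Fin m → Fin K → ℤ)
  (τ : Fin N → Fin L → Fin L → Fin U → Equiv.Perm (Fin m) × (Fin m → Fin K))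
  (s₁ : Fin N → Fin L → ℤ) (s₂ : Fin L → Fin U → ℤ) (A : Fin N → Fin L → ℤ) (B : Fin L → Fin U → ℤ)
  (hinj : ∀ j y p u j' y' p' u', y < p → y' < p' → τ j y p u = τ j' y' p' u' →
    j = j' ∧ y = y' ∧ p = p' ∧ u = u')
  (hpres : ∀ j y p u, y < p → termSign ε (τ j y p u) ≠ 0)
  (hw : ∀ j y p u (θ : ℤ), y < p →
    tropWeight d v θ (τ j y p u) = θ * (s₁ j y + s₂ p u) - (A j y + B p u))

include hinj hpres hw in
/-- the basic comparison: a dominant member beats every other feasible member of the family (explicit weights). -/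
theorem weight_lt {j j' : Fin N} {y y' p p' : Fin L} {u u' : Fin U} {θ : ℤ}
    (hyp : y < p) (hyp' : y' < p') (hdom : IsDominant d v ε θ (τ j y p u))
    (hne : ¬ (j = j' ∧ y = y' ∧ p = p' ∧ u = u')) :
    θ * (s₁ j' y' + s₂ p' u') - (A j' y' + B p' u') < θ * (s₁ j y + s₂ p u) - (A j y + B p u) := by
  have h := hdom.2 (τ j' y' p' u') ?_ (hpres j' y' p' u' hyp')
  · rwa [hw j' y' p' u' θ hyp', hw j y p u θ hyp] at h
  · intro h
    obtain ⟨h1, h2, h3, h4⟩ := hinj _ _ _ _ _ _ _ _ hyp' hyp h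
    exact hne ⟨h1.symm, h2.symm, h3.symm, h4.symm⟩

include hinj hpres hw in
/-- two family members dominant at the SAME slope coincide. -/
theorem eq_of_theta_eq {j j' : Fin N} {y y' p p' : Fin L} {u u' : Fin U} {θ : ℤ}
    (hyp : y < p) (hyp' : y' < p') (h1 : IsDominant d v ε θ (τ j y p u))
    (h2 : IsDominant d v ε θ (τ j' y' p' u')) : j = j' ∧ y = y' ∧ p = p' ∧ u = u' := by
  by_contra hne
  have hne' : ¬ (j' = j ∧ y' = y ∧ p' = p ∧ u' = u) := by
    rintro ⟨e1, e2, e3, e4⟩; exact hne ⟨e1.symm, e2.symm, e3.symm, e4.symm⟩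
  have e1 := weight_lt d v ε τ s₁ s₂ A B hinj hpres hw hyp hyp' h1 hne
  have e2 := weight_lt d v ε τ s₁ s₂ A B hinj hpres hw hyp' hyp h2 hne'
  linarith

include hinj hpres hw in
/-- CROSS EXCHANGE, first register: two dominant members `(j,y,p,u)` at `θ` and `(j',y',p',u')` at `θ' > θ` whose
first registers both sit left of a cut `mid` while both second registers sit right of it (`y, y' < mid ≤ p, p'`) have
`s₁ j y < s₁ j' y'` unless `(j,y) = (j',y')` — the cross pairs `(j',y',p,u)`, `(j,y,p',u')` are feasible competitors. -/
theorem s1_lt_of_cross {j j' : Fin N} {y y' p p' : Fin L} {u u' : Fin U} {θ θ' : ℤ} {mid : ℕ}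
    (hy : (y : ℕ) < mid) (hy' : (y' : ℕ) < mid) (hp : mid ≤ (p : ℕ)) (hp' : mid ≤ (p' : ℕ))
    (h1 : IsDominant d v ε θ (τ j y p u)) (h2 : IsDominant d v ε θ' (τ j' y' p' u')) (hθ : θ < θ')
    (hne : ¬ (j = j' ∧ y = y')) : s₁ j y < s₁ j' y' := by
  obtain ⟨hyp, hyp', hy'p, hyp''⟩ : y < p ∧ y' < p' ∧ y' < p ∧ y < p' :=
    ⟨Fin.lt_def.2 (by omega), Fin.lt_def.2 (by omega), Fin.lt_def.2 (by omega), Fin.lt_def.2 (by omega)⟩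
  have e1 := weight_lt d v ε τ s₁ s₂ A B hinj hpres hw hyp hy'p h1 (j' := j') (u' := u)
    (by rintro ⟨a, b, -, -⟩; exact hne ⟨a, b⟩)
  have e2 := weight_lt d v ε τ s₁ s₂ A B hinj hpres hw hyp' hyp'' h2 (j' := j) (u' := u')
    (by rintro ⟨a, b, -, -⟩; exact hne ⟨a.symm, b.symm⟩)
  nlinarith

include hinj hpres hw in
/-- CROSS EXCHANGE, second register (symmetric). -/
theorem s2_lt_of_cross {j j' : Fin N} {y y' p p' : Fin L} {u u' : Fin U} {θ θ' : ℤ} {mid : ℕ}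
    (hy : (y : ℕ) < mid) (hy' : (y' : ℕ) < mid) (hp : mid ≤ (p : ℕ)) (hp' : mid ≤ (p' : ℕ))
    (h1 : IsDominant d v ε θ (τ j y p u)) (h2 : IsDominant d v ε θ' (τ j' y' p' u')) (hθ : θ < θ')
    (hne : ¬ (p = p' ∧ u = u')) : s₂ p u < s₂ p' u' := by
  obtain ⟨hyp, hyp', hy'p, hyp''⟩ : y < p ∧ y' < p' ∧ y' < p ∧ y < p' :=
    ⟨Fin.lt_def.2 (by omega), Fin.lt_def.2 (by omega), Fin.lt_def.2 (by omega), Fin.lt_def.2 (by omega)⟩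
  have e1 := weight_lt d v ε τ s₁ s₂ A B hinj hpres hw hyp hyp'' h1 (j' := j) (u' := u')
    (by rintro ⟨-, -, a, b⟩; exact hne ⟨a, b⟩)
  have e2 := weight_lt d v ε τ s₁ s₂ A B hinj hpres hw hyp' hy'p h2 (j' := j') (u' := u)
    (by rintro ⟨-, -, a, b⟩; exact hne ⟨a.symm, b.symm⟩)
  nlinarith


include hinj hpres hw in
/-- CROSS COUNT.  The members of the family that are dominant (each at some integer slope) and CROSS a cut —
first register in `[lo, mid)`, second register in `[mid, hi)` — number at most `N·(mid − lo) + U·(hi − mid)`: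
along increasing slope their first registers move forward through the `≤ N(mid−lo)` left points (strictly
increasing `s₁`) and their second registers through the `≤ U(hi−mid)` right points, at least one moving at each
step (a monotone staircase; `card_le_of_biMonotone` with the two RANK statistics).  This is the direct-sum
(«autonomous registers add») count for the cross pairs, which are all feasible. -/
theorem cross_card_le (lo mid hi : ℕ) (C : Finset (Fin N × Fin L × Fin L × Fin U))
    (hC : ∀ i ∈ C, lo ≤ (i.2.1 : ℕ) ∧ (i.2.1 : ℕ) < mid ∧ mid ≤ (i.2.2.1 : ℕ) ∧ (i.2.2.1 : ℕ) < hi ∧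
      ∃ θ : ℤ, IsDominant d v ε θ (τ i.1 i.2.1 i.2.2.1 i.2.2.2)) :
    C.card ≤ N * (mid - lo) + U * (hi - mid) := by
  classical
  rcases C.eq_empty_or_nonempty with hCe | hCne
  · simp [hCe]
  have hex : ∀ i ∈ C, ∃ θ : ℤ, IsDominant d v ε θ (τ i.1 i.2.1 i.2.2.1 i.2.2.2) := fun i hi => (hC i hi).2.2.2.2
  choose! Θ hΘ using hex
  -- rank statistics
  let P1 : Finset (Fin N × Fin L) := Finset.univ.filter (fun q => lo ≤ (q.2 : ℕ) ∧ (q.2 : ℕ) < mid)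
  let P2 : Finset (Fin L × Fin U) := Finset.univ.filter (fun q => mid ≤ (q.1 : ℕ) ∧ (q.1 : ℕ) < hi)
  let f : Fin N × Fin L × Fin L × Fin U → ℕ := fun i => (P1.filter (fun q => s₁ i.1 i.2.1 < s₁ q.1 q.2)).card
  let g : Fin N × Fin L × Fin L × Fin U → ℕ := fun i => (P2.filter (fun q => s₂ q.1 q.2 < s₂ i.2.2.1 i.2.2.2)).card
  -- sizes of the point ranges
  have hP1 : P1.card ≤ N * (mid - lo) := by
    have h := Finset.card_le_card_of_injOn (s := P1)
      (t := (Finset.univ : Finset (Fin N)) ×ˢ Finset.Ico lo mid) (fun q => (q.1, (q.2 : ℕ)))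
      (fun q hq => by
        have hq' := (Finset.mem_filter.1 hq).2
        exact Finset.mem_coe.2 (by simp [hq']))
      (by
        intro a ha b hb hab
        simp only [Prod.mk.injEq] at hab
        exact Prod.ext hab.1 (Fin.ext hab.2))
    simpa [Finset.card_product] using h
  have hP2 : P2.card ≤ U * (hi - mid) := by
    have h := Finset.card_le_card_of_injOn (s := P2)
      (t := Finset.Ico mid hi ×ˢ (Finset.univ : Finset (Fin U))) (fun q => ((q.1 : ℕ), q.2))
      (fun q hq => by
        have hq' := (Finset.mem_filter.1 hq).2
        exact Finset.mem_coe.2 (by simp [hq']))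
      (by
        intro a ha b hb hab
        simp only [Prod.mk.injEq] at hab
        exact Prod.ext (Fin.ext hab.1) hab.2)
    simpa [Finset.card_product, Nat.mul_comm] using h
  -- each member's own point lies in its range and is not counted by its own rank: f i ≤ |P1| − 1, g i ≤ |P2| − 1
  have hfle : ∀ i ∈ C, f i + 1 ≤ N * (mid - lo) := by
    intro i hi
    obtain ⟨h1, h2, -, -, -⟩ := hC i hi
    have hmem : (i.1, i.2.1) ∈ P1 := by simp [P1, h1, h2]
    have hsub : P1.filter (fun q => s₁ i.1 i.2.1 < s₁ q.1 q.2) ⊆ P1.erase (i.1, i.2.1) := by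
      intro q hq
      refine Finset.mem_erase.2 ⟨?_, (Finset.mem_filter.1 hq).1⟩
      rintro rfl; exact lt_irrefl _ (Finset.mem_filter.1 hq).2
    have := Finset.card_le_card hsub; rw [Finset.card_erase_of_mem hmem] at this
    have hpos : 0 < P1.card := Finset.card_pos.2 ⟨_, hmem⟩; simp only [f]; omega
  have hgle : ∀ i ∈ C, g i + 1 ≤ U * (hi - mid) := by
    intro i hi
    obtain ⟨-, -, h3, h4, -⟩ := hC i hi
    have hmem : (i.2.2.1, i.2.2.2) ∈ P2 := by simp [P2, h3, h4]
    have hsub : P2.filter (fun q => s₂ q.1 q.2 < s₂ i.2.2.1 i.2.2.2) ⊆ P2.erase (i.2.2.1, i.2.2.2) := by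
      intro q hq
      refine Finset.mem_erase.2 ⟨?_, (Finset.mem_filter.1 hq).1⟩
      rintro rfl; exact lt_irrefl _ (Finset.mem_filter.1 hq).2
    have := Finset.card_le_card hsub; rw [Finset.card_erase_of_mem hmem] at this
    have hpos : 0 < P2.card := Finset.card_pos.2 ⟨_, hmem⟩; simp only [g]; omega
  -- strict monotonicity of the ranks under the cross exchange
  have hf_lt : ∀ a ∈ C, ∀ b ∈ C, s₁ a.1 a.2.1 < s₁ b.1 b.2.1 → f b < f a := by
    intro a ha b hb hab
    obtain ⟨h1, h2, -, -, -⟩ := hC b hb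
    have hmem : (b.1, b.2.1) ∈ P1 := by simp [P1, h1, h2]
    apply Finset.card_lt_card
    refine ⟨fun q hq => ?_, fun hsub => ?_⟩
    · rw [Finset.mem_filter] at hq ⊢
      exact ⟨hq.1, lt_trans hab hq.2⟩
    · have : (b.1, b.2.1) ∈ P1.filter (fun q => s₁ b.1 b.2.1 < s₁ q.1 q.2) :=
        hsub (Finset.mem_filter.2 ⟨hmem, hab⟩)
      exact lt_irrefl _ (Finset.mem_filter.1 this).2
  have hg_lt : ∀ a ∈ C, ∀ b ∈ C, s₂ a.2.2.1 a.2.2.2 < s₂ b.2.2.1 b.2.2.2 → g a < g b := by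
    intro a ha b hb hab
    obtain ⟨-, -, h3, h4, -⟩ := hC a ha
    have hmem : (a.2.2.1, a.2.2.2) ∈ P2 := by simp [P2, h3, h4]
    apply Finset.card_lt_card
    refine ⟨fun q hq => ?_, fun hsub => ?_⟩
    · rw [Finset.mem_filter] at hq ⊢
      exact ⟨hq.1, lt_trans hq.2 hab⟩
    · have : (a.2.2.1, a.2.2.2) ∈ P2.filter (fun q => s₂ q.1 q.2 < s₂ a.2.2.1 a.2.2.2) :=
        hsub (Finset.mem_filter.2 ⟨hmem, hab⟩)
      exact lt_irrefl _ (Finset.mem_filter.1 this).2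
  have hf_eq : ∀ a b : Fin N × Fin L × Fin L × Fin U, a.1 = b.1 → a.2.1 = b.2.1 → f a = f b := by
    intro a b h1 h2; simp only [f, h1, h2]
  have hg_eq : ∀ a b : Fin N × Fin L × Fin L × Fin U, a.2.2.1 = b.2.2.1 → a.2.2.2 = b.2.2.2 → g a = g b := by
    intro a b h1 h2; simp only [g, h1, h2]
  -- the one-directional chain step
  have hstep : ∀ a ∈ C, ∀ b ∈ C, Θ a < Θ b →
      f b ≤ f a ∧ g a ≤ g b ∧ (f b < f a ∨ g a < g b) := by
    intro a ha b hb hab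
    obtain ⟨-, hya, hpa, -, -⟩ := hC a ha; obtain ⟨-, hyb, hpb, -, -⟩ := hC b hb
    have hda := hΘ a ha; have hdb := hΘ b hb
    by_cases h1 : a.1 = b.1 ∧ a.2.1 = b.2.1
    · -- first registers agree: the second registers must differ and move forward
      have hfe := hf_eq a b h1.1 h1.2
      by_cases h2 : a.2.2.1 = b.2.2.1 ∧ a.2.2.2 = b.2.2.2
      · exfalso
        have hab' : a = b := Prod.ext h1.1 (Prod.ext h1.2 (Prod.ext h2.1 h2.2))
        rw [hab'] at hab; exact lt_irrefl _ hab
      · have hs := s2_lt_of_cross d v ε τ s₁ s₂ A B hinj hpres hw hya hyb hpa hpb hda hdb hab h2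
        have := hg_lt a ha b hb hs
        exact ⟨le_of_eq hfe.symm, le_of_lt this, Or.inr this⟩
    · have hs := s1_lt_of_cross d v ε τ s₁ s₂ A B hinj hpres hw hya hyb hpa hpb hda hdb hab h1
      have hf := hf_lt a ha b hb hs
      by_cases h2 : a.2.2.1 = b.2.2.1 ∧ a.2.2.2 = b.2.2.2
      · have hge := hg_eq a b h2.1 h2.2
        exact ⟨le_of_lt hf, le_of_eq hge, Or.inl hf⟩
      · have hs2 := s2_lt_of_cross d v ε τ s₁ s₂ A B hinj hpres hw hya hyb hpa hpb hda hdb hab h2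
        have hg := hg_lt a ha b hb hs2
        exact ⟨le_of_lt hf, le_of_lt hg, Or.inl hf⟩
  have hch : ∀ a ∈ C, ∀ b ∈ C, a ≠ b →
      (f b ≤ f a ∧ g a ≤ g b ∧ (f b < f a ∨ g a < g b)) ∨
      (f a ≤ f b ∧ g b ≤ g a ∧ (f a < f b ∨ g b < g a)) := by
    intro a ha b hb hab
    rcases lt_trichotomy (Θ a) (Θ b) with hlt | heq | hgt
    · exact Or.inl (hstep a ha b hb hlt)
    · exfalso
      obtain ⟨-, hya, hpa, -, -⟩ := hC a ha; obtain ⟨-, hyb, hpb, -, -⟩ := hC b hb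
      have hda := hΘ a ha; have hdb := hΘ b hb
      rw [heq] at hda
      have hypa : a.2.1 < a.2.2.1 := Fin.lt_def.2 (by omega)
      have hypb : b.2.1 < b.2.2.1 := Fin.lt_def.2 (by omega)
      obtain ⟨e1, e2, e3, e4⟩ := eq_of_theta_eq d v ε τ s₁ s₂ A B hinj hpres hw hypa hypb hda hdb
      exact hab (Prod.ext e1 (Prod.ext e2 (Prod.ext e3 e4)))
    · exact Or.inr (hstep b hb a ha hgt)
  have hmain := card_le_of_biMonotone C hCne f g hch
  -- bound the ranges
  obtain ⟨i0, hi0⟩ := hCne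
  have hsupf : C.sup' ⟨i0, hi0⟩ f + 1 ≤ N * (mid - lo) := by
    obtain ⟨b, hb, hfb⟩ := Finset.exists_mem_eq_sup' ⟨i0, hi0⟩ f
    rw [hfb]; exact hfle b hb
  have hsupg : C.sup' ⟨i0, hi0⟩ g + 1 ≤ U * (hi - mid) := by
    obtain ⟨b, hb, hgb⟩ := Finset.exists_mem_eq_sup' ⟨i0, hi0⟩ g
    rw [hgb]; exact hgle b hb
  have e1 := Nat.sub_le (C.sup' ⟨i0, hi0⟩ f) (C.inf' ⟨i0, hi0⟩ f)
  have e2 := Nat.sub_le (C.sup' ⟨i0, hi0⟩ g) (C.inf' ⟨i0, hi0⟩ g); omega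


open scoped Classical in
include hinj hpres hw in
/-- **THE COMPARABILITY-SUM LAW.**  Inside an arbitrary design `(d, v, ε)` of format `(m, K)` let `τ j y p u`
(`j < N`, `y < L`, `p < L`, `u < U`) be a family of terms which, whenever `y < p`, are PRESENT, pairwise distinct,
and have weights `tropWeight d v θ (τ j y p u) = θ·(s₁ j y + s₂ p u) − (A j y + B p u)` — two REGISTERS
(arbitrary lines indexed by `(j,y)` resp. `(p,u)`) whose slope and valuation simply ADD, coupled ONLY through the
comparability constraint `y < p` on their positions in a common window of length `L`.  Then at most
`(N + U) · L · (⌊log₂ L⌋ + 1)` members with `y < p` are dominant (each at some integer slope).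
Proof: halve the window; a dominant member has both positions in the left half, both in the right half, or
CROSSES the midpoint; crossing members are a direct sum (`cross_card_le`: `≤ N·a + U·b`); recurse dyadically.
Counting alone allows `N·U·L²/2`-type numbers (all slopes `s₁ + s₂` may be distinct); the law is QUASI-QUADRATIC in
the number `N·L + L·U` of register points. -/
theorem card_dominant_le :
    ((Finset.univ : Finset (Fin N × Fin L × Fin L × Fin U)).filter (fun i => i.2.1 < i.2.2.1 ∧
        ∃ θ : ℤ, IsDominant d v ε θ (τ i.1 i.2.1 i.2.2.1 i.2.2.2))).card
      ≤ (N + U) * L * (Nat.log 2 L + 1) := by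
  classical
  set D := (Finset.univ : Finset (Fin N × Fin L × Fin L × Fin U)).filter (fun i => i.2.1 < i.2.2.1 ∧
        ∃ θ : ℤ, IsDominant d v ε θ (τ i.1 i.2.1 i.2.2.1 i.2.2.2)) with hD
  have hmemD : ∀ i ∈ D, i.2.1 < i.2.2.1 ∧ ∃ θ : ℤ, IsDominant d v ε θ (τ i.1 i.2.1 i.2.2.1 i.2.2.2) :=
    fun i hi => (Finset.mem_filter.1 hi).2
  -- dyadic induction over position windows `[lo, lo + len)`
  have key : ∀ k lo len : ℕ, len ≤ 2 ^ k →
      (D.filter (fun i => lo ≤ (i.2.1 : ℕ) ∧ (i.2.2.1 : ℕ) < lo + len)).card ≤ (N + U) * len * k := by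
    intro k
    induction k with
    | zero =>
      intro lo len hlen
      have hlen1 : len ≤ 1 := by rw [pow_zero] at hlen; exact hlen
      have hemp : D.filter (fun i => lo ≤ (i.2.1 : ℕ) ∧ (i.2.2.1 : ℕ) < lo + len) = ∅ := by
        refine Finset.filter_eq_empty_iff.2 ?_
        intro i hi h
        have hyp : (i.2.1 : ℕ) < (i.2.2.1 : ℕ) := Fin.lt_def.1 (hmemD i hi).1
        omega
      rw [hemp]; simp
    | succ k ih =>
      intro lo len hlen
      have hpow : 2 ^ (k + 1) = 2 * 2 ^ k := by ring
      set a := len / 2 with ha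
      set b := len - a with hb
      obtain ⟨hale, hble, hab⟩ : a ≤ 2 ^ k ∧ b ≤ 2 ^ k ∧ a + b = len := ⟨by omega, by omega, by omega⟩
      -- three-way cover: left, right, cross
      have hcov : D.filter (fun i => lo ≤ (i.2.1 : ℕ) ∧ (i.2.2.1 : ℕ) < lo + len) ⊆
          D.filter (fun i => lo ≤ (i.2.1 : ℕ) ∧ (i.2.2.1 : ℕ) < lo + a) ∪
          (D.filter (fun i => lo + a ≤ (i.2.1 : ℕ) ∧ (i.2.2.1 : ℕ) < (lo + a) + b) ∪
           D.filter (fun i => lo ≤ (i.2.1 : ℕ) ∧ (i.2.1 : ℕ) < lo + a ∧ lo + a ≤ (i.2.2.1 : ℕ) ∧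
             (i.2.2.1 : ℕ) < lo + len)) := by
        intro i hi
        rw [Finset.mem_filter] at hi
        obtain ⟨hiD, h1, h2⟩ := hi
        simp only [Finset.mem_union, Finset.mem_filter]
        by_cases hp : (i.2.2.1 : ℕ) < lo + a
        · exact Or.inl ⟨hiD, h1, hp⟩
        · by_cases hy : lo + a ≤ (i.2.1 : ℕ)
          · exact Or.inr (Or.inl ⟨hiD, hy, by omega⟩)
          · exact Or.inr (Or.inr ⟨hiD, h1, by omega, by omega, h2⟩)
      have hcross : (D.filter (fun i => lo ≤ (i.2.1 : ℕ) ∧ (i.2.1 : ℕ) < lo + a ∧ lo + a ≤ (i.2.2.1 : ℕ) ∧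
          (i.2.2.1 : ℕ) < lo + len)).card ≤ N * ((lo + a) - lo) + U * ((lo + len) - (lo + a)) := by
        refine cross_card_le d v ε τ s₁ s₂ A B hinj hpres hw lo (lo + a) (lo + len) _ ?_
        intro i hi
        rw [Finset.mem_filter] at hi
        obtain ⟨hiD, h1, h2, h3, h4⟩ := hi
        exact ⟨h1, h2, h3, h4, (hmemD i hiD).2⟩
      have e1 : (lo + a) - lo = a := by omega
      have e2 : (lo + len) - (lo + a) = b := by omega
      rw [e1, e2] at hcross
      calc (D.filter (fun i => lo ≤ (i.2.1 : ℕ) ∧ (i.2.2.1 : ℕ) < lo + len)).card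
          ≤ (D.filter (fun i => lo ≤ (i.2.1 : ℕ) ∧ (i.2.2.1 : ℕ) < lo + a) ∪
            (D.filter (fun i => lo + a ≤ (i.2.1 : ℕ) ∧ (i.2.2.1 : ℕ) < (lo + a) + b) ∪
             D.filter (fun i => lo ≤ (i.2.1 : ℕ) ∧ (i.2.1 : ℕ) < lo + a ∧ lo + a ≤ (i.2.2.1 : ℕ) ∧
               (i.2.2.1 : ℕ) < lo + len))).card := Finset.card_le_card hcov
        _ ≤ (D.filter (fun i => lo ≤ (i.2.1 : ℕ) ∧ (i.2.2.1 : ℕ) < lo + a)).card +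
            ((D.filter (fun i => lo + a ≤ (i.2.1 : ℕ) ∧ (i.2.2.1 : ℕ) < (lo + a) + b)).card +
             (D.filter (fun i => lo ≤ (i.2.1 : ℕ) ∧ (i.2.1 : ℕ) < lo + a ∧ lo + a ≤ (i.2.2.1 : ℕ) ∧
               (i.2.2.1 : ℕ) < lo + len)).card) :=
            le_trans (Finset.card_union_le _ _) (Nat.add_le_add_left (Finset.card_union_le _ _) _)
        _ ≤ (N + U) * a * k + ((N + U) * b * k + (N * a + U * b)) :=
            Nat.add_le_add (ih lo a hale) (Nat.add_le_add (ih (lo + a) b hble) hcross)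
        _ ≤ (N + U) * len * (k + 1) := by
            rw [← hab]
            nlinarith [Nat.zero_le (U * a), Nat.zero_le (N * b), Nat.zero_le ((N + U) * k)]
  have hL : L ≤ 2 ^ (Nat.log 2 L + 1) := (Nat.lt_pow_succ_log_self (by norm_num) L).le
  have hall : D.filter (fun i => 0 ≤ (i.2.1 : ℕ) ∧ (i.2.2.1 : ℕ) < 0 + L) = D :=
    Finset.filter_true_of_mem (fun i _ => ⟨Nat.zero_le _, by rw [Nat.zero_add]; exact i.2.2.1.isLt⟩)
  rw [← hall]
  exact key _ 0 L hL

end Family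

end Summit.ValiantsHypothesis.ValiantsHypothesis.Theorems.KPlusLogSqLaw.ComparabilitySum
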